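import Literature.NumberTheory.LFunctions.LagariasXiPositivity
import Literature.NumberTheory.LFunctions.ZetaLogDerivRePartialFraction
import Literature.NumberTheory.LFunctions.ZetaZeroReciprocalSum
import Literature.NumberTheory.LFunctions.FordZetaZeroRecipSqSum
import Literature.NumberTheory.LFunctions.ZetaFirstZeroCertificate
import Literature.NumberTheory.LFunctions.RiemannXiLogDeriv
import Literature.NumberTheory.LFunctions.WeilZeroSum
import Literature.NumberTheory.LFunctions.RHInvZetaBound
import HarnessLib

/-!
# Lagarias 1999, Theorem 1.3 — I: the zero side (`Re ξ'/ξ` under RH as a sum over the zeros)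

Topic `Literature/NumberTheory/LFunctions`. Pure proof file (nothing is asserted, no definition): the
first of the files proving `Literature.NumberTheory.LFunctions.Lagarias1999_thm13`
(`LagariasXiPositivity.lean`; J. C. Lagarias, *On a positivity property of the Riemann ξ-function*,
Acta Arith. 89 (1999), Thm. 1.3: under RH, `Re ξ'/ξ(σ + it) ≥ ξ'(σ)/ξ(σ)` for `σ > ½`), following
§3 of the paper.

Under the Riemann hypothesis every non-trivial zero is `ρ = ½ + iγ` (and `ζ ≠ 0` on `Re s > ½`,
`Literature.NumberTheory.LFunctions.InvZetaRH.riemannZeta_ne_zero_of_RH`), and the tree's partial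
fraction `Re ξ'/ξ(s) = Σ_ρ m(ρ) Re 1/(s − ρ)` with multiplicities
(`Literature.NumberTheory.LFunctions.hasSum_zeroOrder_mul_re_inv_sub`) becomes Lagarias's (3.2):
`Re ξ'/ξ(σ + it) = Σ_ρ m(ρ) (σ − ½)/((σ − ½)² + (t − γ)²)` (`hasSum_re_logDeriv_riemannXi_of_RH`).
From it:

* `re_logDeriv_riemannXi_ofReal_le_of_RH` — **Lemma 3.3** (the `t = 0` side): for `σ > ½`,
  `ξ'(σ)/ξ(σ) ≤ 0.046251 (σ − ½)`, from `Σ_ρ m(ρ)/|ρ|² = β = 2 + γ − log 4π < 0.046192`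
  (`Literature.NumberTheory.LFunctions.hasSum_zeroOrder_div_norm_sq_of_RH`,
  `Literature.NumberTheory.LFunctions.FordL33.nicolasBeta_lt_d5`) and `|γ| > 14` for every zero
  (`Literature.NumberTheory.LFunctions.FordL33.fourteen_lt_abs_im`), so that
  `1/γ² ≤ (785/784)/|ρ|²`. (Lagarias has `0.047`; we keep one more digit.)
* `re_logDeriv_riemannXi_le_of_abs_le` — **Lemmas 3.1–3.2** (`|t| ≤ 21`, here for all
  `½ < σ ≤ 25/2`): `Re ξ'/ξ(σ ± it)` are equal (`ξ'/ξ(s̄) = conj ξ'/ξ(s)`), and termwise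
  `a/(a² + (t−γ)²) + a/(a² + (t+γ)²) ≥ 2a/(a² + γ²)` as soon as `a² + t² ≤ 3γ²` (Lemma 3.1), which
  holds because `γ² > 196` and `a² + t² ≤ 144 + 441 < 588`.
* `re_logDeriv_riemannXi_le_of_located_zeros` — **Lemma 3.4** in quantitative form: for
  `½ < σ ≤ 9/2`, any finite set `T` of zeros of `ζ` off the real axis with
  `Σ_{ρ ∈ T} 1/(16 + (t − Im ρ)²) ≥ 0.046251` gives `Re ξ'/ξ(σ + it) ≥ ξ'(σ)/ξ(σ)` (drop the other
  zeros, `m(ρ) ≥ 1`, `(σ − ½)² ≤ 16`). One zero within `2.35` of `t`, or two within `5.2`, suffice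
  (`1/(16 + 2.35²) = 0.04646…`, `2/(16 + 5.2²) = 0.04646…`).

The remaining ranges (the located zeros for `21 ≤ |t|`, and `σ ≥ 9/2` by the gamma factor) are in the
sibling files `LagariasXiPositivityTable.lean`, `LagariasXiPositivityTuring.lean`,
`LagariasXiPositivityGamma.lean`; the assembly is `LagariasXiPositivityProofs.lean`.

## References

* J. C. Lagarias, *On a positivity property of the Riemann ξ-function*, Acta Arith. 89 (1999),
  217–234, §3, (3.2), Lemmas 3.1–3.4. [LagariasXiPositivity1999]
-/

noncomputable section

open Complex Real
open scoped ComplexConjugate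

namespace Literature.NumberTheory.LFunctions

namespace Lagarias1999

/-! ### Zeros under RH -/

/-- `196 < (Im ρ)²` for every non-trivial zero (`|Im ρ| > 14`:
`Literature.NumberTheory.LFunctions.FordL33.fourteen_lt_abs_im`, from the kernel-checked
`N(14) = 0`; Lagarias, proof of Lemma 3.2: "`|γ| > 14.134`").
[cite: LagariasXiPositivity1999, Lemma 3.2 (proof)] -/
theorem sq_im_gt (ρ : RHWave0.riemannZetaNontrivialZeros) : 196 < (ρ : ℂ).im ^ 2 := by
  have h := FordL33.fourteen_lt_abs_im ρ
  have h14 : (0 : ℝ) ≤ 14 := by norm_num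
  nlinarith [abs_nonneg (ρ : ℂ).im, sq_abs (ρ : ℂ).im]


/-! ### (3.2): `Re ξ'/ξ(σ + it) = Σ_ρ m(ρ) (σ − ½)/((σ − ½)² + (t − γ)²)` under RH -/

/-- **Lagarias (3.2)**: under RH, for `σ > ½` and real `t`,
`Re ξ'/ξ(σ + it) = Σ_ρ m(ρ) · (σ − ½)/((σ − ½)² + (t − Im ρ)²)`, the sum over the non-trivial zeros
with multiplicity (absolutely convergent, positive terms). [cite: LagariasXiPositivity1999, (3.2)] -/
theorem hasSum_re_logDeriv_riemannXi_of_RH (hRH : RiemannHypothesis) {σ : ℝ} (hσ : 1 / 2 < σ)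
    (t : ℝ) :
    HasSum (fun ρ : RHWave0.riemannZetaNontrivialZeros ↦
      (riemannZetaZeroOrder (ρ : ℂ) : ℝ) * ((σ - 1 / 2) / ((σ - 1 / 2) ^ 2 + (t - (ρ : ℂ).im) ^ 2)))
      (logDeriv riemannXi ((σ : ℂ) + t * I)).re := by
  -- under RH every non-trivial zero has real part `½` (cf. `NicolasJExplicit.re_eq_half_of_RH`)
  have hre : ∀ ρ : RHWave0.riemannZetaNontrivialZeros, (ρ : ℂ).re = 1 / 2 := fun ρ ↦ by
    refine hRH ρ (ZetaZeros.riemannZetaNontrivialZeros.zeta_eq_zero ρ.2) ?_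
      (ZetaZeros.riemannZetaNontrivialZeros.ne_one ρ.2)
    rintro ⟨n, hn⟩
    have := ZetaZeros.riemannZetaNontrivialZeros.re_pos ρ.2
    rw [hn] at this
    simp at this
    linarith [(n.cast_nonneg : (0 : ℝ) ≤ n)]
  have hs : ((σ : ℂ) + t * I).re = σ := by simp
  have hζ : riemannZeta ((σ : ℂ) + t * I) ≠ 0 :=
    InvZetaRH.riemannZeta_ne_zero_of_RH hRH (by rw [hs]; exact hσ)
  refine (hasSum_zeroOrder_mul_re_inv_sub hζ).congr_fun fun ρ ↦ ?_
  congr 1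
  rw [IsHadamardSeq.re_inv_sub_eq, Complex.sq_norm, Complex.normSq_apply]
  simp [hre ρ]
  ring

/-- The same at `t = 0`: `ξ'(σ)/ξ(σ) = Σ_ρ m(ρ)(σ − ½)/((σ − ½)² + γ²)` (Lagarias (3.10)).
[cite: LagariasXiPositivity1999, (3.10)] -/
theorem hasSum_re_logDeriv_riemannXi_ofReal_of_RH (hRH : RiemannHypothesis) {σ : ℝ}
    (hσ : 1 / 2 < σ) :
    HasSum (fun ρ : RHWave0.riemannZetaNontrivialZeros ↦
      (riemannZetaZeroOrder (ρ : ℂ) : ℝ) * ((σ - 1 / 2) / ((σ - 1 / 2) ^ 2 + (ρ : ℂ).im ^ 2)))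
      (logDeriv riemannXi (σ : ℂ)).re := by
  have h := hasSum_re_logDeriv_riemannXi_of_RH hRH hσ 0
  simp only [ofReal_zero, zero_mul, add_zero, zero_sub, even_two, Even.neg_pow] at h
  exact h

/-- `Re ξ'/ξ(σ − it) = Re ξ'/ξ(σ + it)` (`ξ'/ξ(s̄) = conj ξ'/ξ(s)`). [folklore] -/
theorem re_logDeriv_riemannXi_neg (σ t : ℝ) :
    (logDeriv riemannXi ((σ : ℂ) + (-t : ℝ) * I)).re = (logDeriv riemannXi ((σ : ℂ) + t * I)).re := by
  have hc : ((σ : ℂ) + (-t : ℝ) * I) = conj ((σ : ℂ) + t * I) := by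
    apply Complex.ext <;> simp
  rw [hc, logDeriv_riemannXi_conj, Complex.conj_re]

/-! ### Lemma 3.3: the value on the real axis -/

/-- **Lemma 3.3** (Lagarias: `0 ≤ ξ'(σ)/ξ(σ) ≤ 0.047(σ − ½)` under RH), sharpened by one digit:
for `σ > ½`, `ξ'(σ)/ξ(σ) ≤ 0.046251 (σ − ½)`. Proof as printed ((3.10)–(3.12)): termwise
`(σ−½)/((σ−½)² + γ²) ≤ (σ−½)/γ² ≤ (σ−½)(1 + 1/784)/|ρ|²` (`γ² > 196`, `|ρ|² = ¼ + γ²`) and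
`Σ m(ρ)/|ρ|² = β < 0.046192`. [cite: LagariasXiPositivity1999, Lemma 3.3] -/
theorem re_logDeriv_riemannXi_ofReal_le_of_RH (hRH : RiemannHypothesis) {σ : ℝ} (hσ : 1 / 2 < σ) :
    (logDeriv riemannXi (σ : ℂ)).re ≤ 46251 / 1000000 * (σ - 1 / 2) := by
  -- under RH every non-trivial zero has real part `½` (cf. `NicolasJExplicit.re_eq_half_of_RH`)
  have hre : ∀ ρ : RHWave0.riemannZetaNontrivialZeros, (ρ : ℂ).re = 1 / 2 := fun ρ ↦ by
    refine hRH ρ (ZetaZeros.riemannZetaNontrivialZeros.zeta_eq_zero ρ.2) ?_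
      (ZetaZeros.riemannZetaNontrivialZeros.ne_one ρ.2)
    rintro ⟨n, hn⟩
    have := ZetaZeros.riemannZetaNontrivialZeros.re_pos ρ.2
    rw [hn] at this
    simp at this
    linarith [(n.cast_nonneg : (0 : ℝ) ≤ n)]
  have h1 := hasSum_re_logDeriv_riemannXi_ofReal_of_RH hRH hσ
  have h2 := (hasSum_zeroOrder_div_norm_sq_of_RH hRH).mul_left ((σ - 1 / 2) * (785 / 784))
  have hβ := FordL33.nicolasBeta_lt_d5
  have ha : 0 < σ - 1 / 2 := by linarith
  have hle := hasSum_le (fun ρ ↦ ?_) h1 h2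
  · have : (σ - 1 / 2) * (785 / 784) * nicolasBeta ≤ 46251 / 1000000 * (σ - 1 / 2) := by
      nlinarith
    linarith
  -- termwise comparison
  have hm := ZetaZeroSum.zeroOrder_nonneg ρ
  have hγ := sq_im_gt ρ
  have hnorm : ‖(ρ : ℂ)‖ ^ 2 = 1 / 4 + (ρ : ℂ).im ^ 2 := by
    rw [Complex.sq_norm, Complex.normSq_apply, hre ρ]; ring
  rw [hnorm]
  have hkey : (σ - 1 / 2) / ((σ - 1 / 2) ^ 2 + (ρ : ℂ).im ^ 2) ≤
      (σ - 1 / 2) * (785 / 784) / (1 / 4 + (ρ : ℂ).im ^ 2) := by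
    rw [div_le_div_iff₀ (by positivity) (by positivity)]
    nlinarith [sq_nonneg (σ - 1 / 2)]
  calc (riemannZetaZeroOrder (ρ : ℂ) : ℝ) * ((σ - 1 / 2) / ((σ - 1 / 2) ^ 2 + (ρ : ℂ).im ^ 2))
      ≤ (riemannZetaZeroOrder (ρ : ℂ) : ℝ) * ((σ - 1 / 2) * (785 / 784) / (1 / 4 + (ρ : ℂ).im ^ 2)) :=
        mul_le_mul_of_nonneg_left hkey hm
    _ = (σ - 1 / 2) * (785 / 784) * ((riemannZetaZeroOrder (ρ : ℂ) : ℝ) / (1 / 4 + (ρ : ℂ).im ^ 2)) := by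
        ring

/-! ### Lemmas 3.1–3.2: `|t| ≤ 21` -/

/-- **Lemma 3.1** (Lagarias, unconditional real inequality): for `a > 0` and `a² + t² ≤ 3γ²`,
`a/(a² + (t − γ)²) + a/(a² + (t + γ)²) ≥ 2a/(a² + γ²)`
(the difference is `2at²(3γ² − a² − t²)/(product of the denominators)`).
[cite: LagariasXiPositivity1999, Lemma 3.1] -/
theorem two_mul_div_le_add {a t γ : ℝ} (ha : 0 < a) (h : a ^ 2 + t ^ 2 ≤ 3 * γ ^ 2) :
    2 * (a / (a ^ 2 + γ ^ 2)) ≤ a / (a ^ 2 + (t - γ) ^ 2) + a / (a ^ 2 + (t + γ) ^ 2) := by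
  have hP : 0 < a ^ 2 + (t - γ) ^ 2 := by positivity
  have hQ : 0 < a ^ 2 + (t + γ) ^ 2 := by positivity
  have hR : 0 < a ^ 2 + γ ^ 2 := by positivity
  have key : a / (a ^ 2 + (t - γ) ^ 2) + a / (a ^ 2 + (t + γ) ^ 2) - 2 * (a / (a ^ 2 + γ ^ 2)) =
      2 * a * t ^ 2 * (3 * γ ^ 2 - a ^ 2 - t ^ 2) /
        ((a ^ 2 + (t - γ) ^ 2) * (a ^ 2 + (t + γ) ^ 2) * (a ^ 2 + γ ^ 2)) := by
    field_simp
    ring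
  have hnn : 0 ≤ 2 * a * t ^ 2 * (3 * γ ^ 2 - a ^ 2 - t ^ 2) /
      ((a ^ 2 + (t - γ) ^ 2) * (a ^ 2 + (t + γ) ^ 2) * (a ^ 2 + γ ^ 2)) := by
    apply div_nonneg _ (by positivity)
    have : 0 ≤ 3 * γ ^ 2 - a ^ 2 - t ^ 2 := by linarith
    positivity
  linarith

/-- **Lemma 3.2** (Lagarias: RH, `½ < σ ≤ 10`, `0 < |t| ≤ 21`; here `½ < σ ≤ 25/2`, `|t| ≤ 21`):
`ξ'(σ)/ξ(σ) ≤ Re ξ'/ξ(σ + it)`. Proof as printed: average (3.2) at `±t` (the two real parts are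
equal) and apply Lemma 3.1 termwise, `3γ² > 588 > (σ − ½)² + t²` since every zero has `|γ| > 14`.
[cite: LagariasXiPositivity1999, Lemma 3.2] -/
theorem re_logDeriv_riemannXi_le_of_abs_le (hRH : RiemannHypothesis) {σ t : ℝ} (hσ : 1 / 2 < σ)
    (hσ' : σ ≤ 25 / 2) (ht : |t| ≤ 21) :
    (logDeriv riemannXi (σ : ℂ)).re ≤ (logDeriv riemannXi ((σ : ℂ) + t * I)).re := by
  have h0 := hasSum_re_logDeriv_riemannXi_ofReal_of_RH hRH hσ
  have hp := hasSum_re_logDeriv_riemannXi_of_RH hRH hσ t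
  have hn := hasSum_re_logDeriv_riemannXi_of_RH hRH hσ (-t)
  rw [re_logDeriv_riemannXi_neg] at hn
  have hsum := hp.add hn
  have h02 := h0.mul_left 2
  have ha : 0 < σ - 1 / 2 := by linarith
  have ht2 : t ^ 2 ≤ 441 := by
    have : |t| ^ 2 ≤ 21 ^ 2 := by gcongr
    rw [sq_abs] at this; linarith
  have hle := hasSum_le (fun ρ ↦ ?_) h02 hsum
  · linarith
  have hm := ZetaZeroSum.zeroOrder_nonneg ρ
  have hγ := sq_im_gt ρ
  have h3 : (σ - 1 / 2) ^ 2 + t ^ 2 ≤ 3 * (ρ : ℂ).im ^ 2 := by nlinarith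
  have key := two_mul_div_le_add (t := t) (γ := (ρ : ℂ).im) ha h3
  have e : (-t - (ρ : ℂ).im) ^ 2 = (t + (ρ : ℂ).im) ^ 2 := by ring
  rw [e]
  nlinarith

/-! ### Lemma 3.4: located zeros near `t` -/

/-- **Lemma 3.4, quantitative form.** Under RH, for `½ < σ ≤ 9/2` and real `t`: if `T` is a
finite set of zeros of `ζ` off the real axis (hence non-trivial) with
`Σ_{ρ ∈ T} 1/(16 + (t − Im ρ)²) ≥ 0.046251`, then `ξ'(σ)/ξ(σ) ≤ Re ξ'/ξ(σ + it)`. Proof as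
printed: in (3.2) drop all zeros outside `T` (all terms are `≥ 0`), use `m(ρ) ≥ 1` and
`(σ − ½)² ≤ 16`, so `Re ξ'/ξ(σ + it) ≥ (σ − ½) Σ_T 1/(16 + (t−γ)²) ≥ 0.046251 (σ − ½)`, and
Lemma 3.3. [cite: LagariasXiPositivity1999, Lemma 3.4] -/
theorem re_logDeriv_riemannXi_le_of_located_zeros (hRH : RiemannHypothesis) {σ t : ℝ}
    (hσ : 1 / 2 < σ) (hσ' : σ ≤ 9 / 2) (T : Finset ℂ)
    (hT : ∀ ρ ∈ T, riemannZeta ρ = 0 ∧ ρ.im ≠ 0)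
    (hsum : 46251 / 1000000 ≤ ∑ ρ ∈ T, 1 / (16 + (t - ρ.im) ^ 2)) :
    (logDeriv riemannXi (σ : ℂ)).re ≤ (logDeriv riemannXi ((σ : ℂ) + t * I)).re := by
  classical
  have ha : 0 < σ - 1 / 2 := by linarith
  have ha2 : (σ - 1 / 2) ^ 2 ≤ 16 := by nlinarith
  have h0 := re_logDeriv_riemannXi_ofReal_le_of_RH hRH hσ
  have hp := hasSum_re_logDeriv_riemannXi_of_RH hRH hσ t
  -- the located zeros as a finset of the index type
  have hmem : ∀ ρ ∈ T, ρ ∈ RHWave0.riemannZetaNontrivialZeros := fun ρ hρ ↦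
    ZetaZeros.riemannZetaNontrivialZeros.mem_of_im_ne_zero (hT ρ hρ).1 (hT ρ hρ).2
  set S : Finset RHWave0.riemannZetaNontrivialZeros :=
    T.subtype (· ∈ RHWave0.riemannZetaNontrivialZeros) with hS
  have hpart := sum_le_hasSum S (fun ρ _ ↦ mul_nonneg (ZetaZeroSum.zeroOrder_nonneg ρ)
    (div_nonneg ha.le (by positivity))) hp
  have hSsum : ∑ ρ ∈ S, (riemannZetaZeroOrder (ρ : ℂ) : ℝ) *
      ((σ - 1 / 2) / ((σ - 1 / 2) ^ 2 + (t - (ρ : ℂ).im) ^ 2)) =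
      ∑ ρ ∈ T, (riemannZetaZeroOrder ρ : ℝ) * ((σ - 1 / 2) / ((σ - 1 / 2) ^ 2 + (t - ρ.im) ^ 2)) := by
    rw [hS]
    exact Finset.sum_subtype_of_mem (f := fun ρ : ℂ ↦ (riemannZetaZeroOrder ρ : ℝ) *
      ((σ - 1 / 2) / ((σ - 1 / 2) ^ 2 + (t - ρ.im) ^ 2))) hmem
  rw [hSsum] at hpart
  -- termwise: `m(ρ) (σ−½)/((σ−½)² + (t−γ)²) ≥ (σ−½)/(16 + (t−γ)²)`
  have hterm : ∀ ρ ∈ T, (σ - 1 / 2) * (1 / (16 + (t - ρ.im) ^ 2)) ≤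
      (riemannZetaZeroOrder ρ : ℝ) * ((σ - 1 / 2) / ((σ - 1 / 2) ^ 2 + (t - ρ.im) ^ 2)) := by
    intro ρ hρ
    have hm : (1 : ℝ) ≤ riemannZetaZeroOrder ρ := by
      exact_mod_cast ZetaZeros.riemannZetaNontrivialZeros.one_le_order (hmem ρ hρ)
    have hd : 0 < (σ - 1 / 2) ^ 2 + (t - ρ.im) ^ 2 := by positivity
    calc (σ - 1 / 2) * (1 / (16 + (t - ρ.im) ^ 2))
        ≤ (σ - 1 / 2) * (1 / ((σ - 1 / 2) ^ 2 + (t - ρ.im) ^ 2)) := by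
          apply mul_le_mul_of_nonneg_left _ ha.le
          exact one_div_le_one_div_of_le hd (by linarith)
      _ = 1 * ((σ - 1 / 2) / ((σ - 1 / 2) ^ 2 + (t - ρ.im) ^ 2)) := by ring
      _ ≤ (riemannZetaZeroOrder ρ : ℝ) * ((σ - 1 / 2) / ((σ - 1 / 2) ^ 2 + (t - ρ.im) ^ 2)) :=
          mul_le_mul_of_nonneg_right hm (div_nonneg ha.le hd.le)
  have hfin := Finset.sum_le_sum hterm
  rw [← Finset.mul_sum] at hfin
  have : 46251 / 1000000 * (σ - 1 / 2) ≤ (σ - 1 / 2) * ∑ ρ ∈ T, 1 / (16 + (t - ρ.im) ^ 2) := by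
    nlinarith
  linarith

/-- **One zero within `2.35`**: under RH, for `½ < σ ≤ 9/2`, a zero `ρ` of `ζ` off the real axis
with `|t − Im ρ| ≤ 2.35` gives `ξ'(σ)/ξ(σ) ≤ Re ξ'/ξ(σ + it)` (Lagarias, Lemma 3.4 (i), with `2`).
[cite: LagariasXiPositivity1999, Lemma 3.4 (i)] -/
theorem re_logDeriv_riemannXi_le_of_one_zero (hRH : RiemannHypothesis) {σ t : ℝ}
    (hσ : 1 / 2 < σ) (hσ' : σ ≤ 9 / 2) {ρ : ℂ} (hρ : riemannZeta ρ = 0) (him : ρ.im ≠ 0)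
    (hd : |t - ρ.im| ≤ 47 / 20) :
    (logDeriv riemannXi (σ : ℂ)).re ≤ (logDeriv riemannXi ((σ : ℂ) + t * I)).re := by
  refine re_logDeriv_riemannXi_le_of_located_zeros hRH hσ hσ' {ρ} (by simpa using ⟨hρ, him⟩) ?_
  rw [Finset.sum_singleton]
  have hsq : (t - ρ.im) ^ 2 ≤ (47 / 20) ^ 2 := by
    have := abs_le.1 hd; nlinarith
  rw [div_le_div_iff₀ (by norm_num) (by positivity)]
  nlinarith

/-- **Two zeros within `5.2`**: under RH, for `½ < σ ≤ 9/2`, two distinct zeros `ρ₁ ≠ ρ₂` of `ζ`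
off the real axis with `|t − Im ρⱼ| ≤ 5.2` give `ξ'(σ)/ξ(σ) ≤ Re ξ'/ξ(σ + it)` (Lagarias, Lemma
3.4 (ii), with `5`; a double zero is the case `T = {ρ}` of
`re_logDeriv_riemannXi_le_of_located_zeros` and is not needed below).
[cite: LagariasXiPositivity1999, Lemma 3.4 (ii)] -/
theorem re_logDeriv_riemannXi_le_of_two_zeros (hRH : RiemannHypothesis) {σ t : ℝ}
    (hσ : 1 / 2 < σ) (hσ' : σ ≤ 9 / 2) {ρ₁ ρ₂ : ℂ} (hne : ρ₁ ≠ ρ₂)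
    (h₁ : riemannZeta ρ₁ = 0) (hi₁ : ρ₁.im ≠ 0) (hd₁ : |t - ρ₁.im| ≤ 26 / 5)
    (h₂ : riemannZeta ρ₂ = 0) (hi₂ : ρ₂.im ≠ 0) (hd₂ : |t - ρ₂.im| ≤ 26 / 5) :
    (logDeriv riemannXi (σ : ℂ)).re ≤ (logDeriv riemannXi ((σ : ℂ) + t * I)).re := by
  refine re_logDeriv_riemannXi_le_of_located_zeros hRH hσ hσ' {ρ₁, ρ₂} ?_ ?_
  · intro ρ hρ
    rw [Finset.mem_insert, Finset.mem_singleton] at hρ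
    rcases hρ with rfl | rfl
    exacts [⟨h₁, hi₁⟩, ⟨h₂, hi₂⟩]
  rw [Finset.sum_pair hne]
  have hsq₁ : (t - ρ₁.im) ^ 2 ≤ (26 / 5) ^ 2 := by have := abs_le.1 hd₁; nlinarith
  have hsq₂ : (t - ρ₂.im) ^ 2 ≤ (26 / 5) ^ 2 := by have := abs_le.1 hd₂; nlinarith
  have e₁ : 1 / (16 + (26 / 5 : ℝ) ^ 2) ≤ 1 / (16 + (t - ρ₁.im) ^ 2) :=
    one_div_le_one_div_of_le (by positivity) (by linarith)
  have e₂ : 1 / (16 + (26 / 5 : ℝ) ^ 2) ≤ 1 / (16 + (t - ρ₂.im) ^ 2) :=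
    one_div_le_one_div_of_le (by positivity) (by linarith)
  norm_num at e₁ e₂ ⊢
  linarith

end Lagarias1999

end Literature.NumberTheory.LFunctions

end
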